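/-
Copyright: the b2b-balaban T⁴-continuum CRUX team, row NE7b OWNER lineage `t4-ne7b-p1` (gen 120). Project licence.
-/
import Summits.QuantumFields.BalabanUV.T4Continuum.Spine.NE7b.SupTorusConjugatedForm

/-!
# THE INVERSE HESSIAN OF THE TORUS ACTION IS LOCAL AT THE BLOCK SCALE — UNIFORMLY IN THE FIELD, THE MESH AND THE VOLUME:
# for `H = (n+1)²(−Δ) + a(n+1)^{−d}·(block sums) + V` on the fine torus `(ℤ∕(n+1)s)^d` with ANY diagonal `V ≥ −λ`, `λ < min(2,a)`
# (the Hessian `At + diag(u′∘φ)` of the torus action at ANY field), there is `κ = κ(d, a, λ) > 0` such that every column of `H⁻¹`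
# obeys `|H⁻¹(x,z)| ≤ (2∕(min(2,a) − λ))·e^{−κ·(ρ x − ρ z)∕(n+1)}` for EVERY bond-Lipschitz observable `ρ` — decay at the BLOCK scale
# `(n+1)`, every mesh `n`, every period `s`; with the weighted resolvent letter `‖e^{κρ∕(n+1)}u‖₂ ≤ m_κ⁻¹‖e^{κρ∕(n+1)}Hu‖₂` behind it
# (row NE7b, node U5c; (130) `…SupTorusConjugatedForm` BY NAME; [folklore])

Cell `pub-balaban`, sub-cell `t4`, spine estimate NE7b (`T4WeightBudget.RelWeightBound`; the cell's OWN estimate — NOT PRINTED in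
[Bałaban 1983–89], NOT PROVED).  Crux-route work under `Spine/NE7b/` by the row OWNER (`t4-ne7b-p1` gen 120, file (131)) under FREEZE
(0)'s crux-prover clause, REOPENING the OWNER g118's recorded dead end «mesh-UNIFORM locality of the response … NOT reachable by weighted
`ℓ²` energy with the hard block constraint» by a different route (Combes–Thomas on the UNCONSTRAINED coercive form, smooth weights —
(130)'s WHY); NOTHING of Bałaban's is named as a Lean object, valued or asserted; no `T4Continuum/Support` leaf typed; no `def`, no
notation (the operator enters through its DISPLAYED action `Hu = f`, the observable through its displayed bond letter); zero `sorry`.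
Imports (BY NAME): the OWNER's (130) `…SupTorusConjugatedForm` (`weighted_form_lower`; through it (89) TDFC, TDF, `B6QGQLower276`
(`chart`, `B`, `blk`, `e`, `e_apply_self`, `e_apply_ne`), `Beta.{Site, siteOf, windowMap, siteOf_add}`), Mathlib's
`Real.sum_mul_le_sqrt_mul_sqrt` (Cauchy–Schwarz) and `Real.abs_exp_sub_one_le`.

WHY (located).  The torus road ((89)–(123)) has every constant field- and mesh-free EXCEPT locality: the response `DΦ(w)`, the
fluctuation covariance and the Laplace corrections are controlled only globally (`ℓ²` ∕ condition numbers, widths `∝ |σ|`), and g118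
recorded the `ℓ²`-Agmon road on `ker Q′t` as dead (block-constant weights lose `(n+1)²` at block boundaries; smooth weights break the
constraint).  The unconstrained Hessian needs neither: (130) gives the floor `m_κ = min(2,a) − λ − 2dκ² − a(e^{2dκ} − 1)` of the form of
`e^{w}He^{−w}` for `w = (κ∕(n+1))·ρ`, `ρ` bond-Lipschitz (bond letter `κ∕(n+1)`, block letter `2dκ` — a torus block is `≤ dn` bond
steps across from its corner); pairing `Hu = f` with `e^{2w}u` and Cauchy–Schwarz turn the floor into the weighted resolvent letter,
a single term of the weighted sum into the pointwise letter, and a point source `f = c·δ_z` into the two-point decay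
`|u x| ≤ (|c|∕m_κ)e^{−(w x − w z)}`.  Taking `ρ = dist(·, z)` for any bond-1-Lipschitz torus distance gives the usual kernel decay; the
statement is kept for EVERY bond-Lipschitz `ρ` (distance to a point, to a set, a coordinate …), which is the form the coarse Schur
complement `Q′t H⁻¹ Q′t*` and the response `H⁻¹Q′t*(Q′tH⁻¹Q′t*)⁻¹` will consume (sequel; the coarse inverse by `B4Sect5Torus.sect5_uniform`).

WHAT IS PROVED ([folklore]; fine torus `Site d ((n+1)s)`, coarse torus `Site d s`, `[NeZero s]`, `ê_μ = siteOf (e μ)`, `σ = siteOf`,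
`wm = windowMap`; `(Hu)(x) := (n+1)²Σ_μ(2u x − u(x+ê_μ) − u(x−ê_μ)) + a(n+1)^{−d}Σ_{q∈B n (blk n (wm x))} u(σ q) + V x·u x` DISPLAYED;
`m_w := min(2,a) − λ − 2d((n+1)τ)² − a(e^β − 1)` for a weight with bond letter `τ ≤ 1` and block letter `β`; `a ≥ 0`, `V ≥ −λ`):
* §1 **`weighted_resolvent_le`** (`Hu = f`, `m_w > 0` ⟹ `√(Σ(e^{w}u)²) ≤ m_w⁻¹√(Σ(e^{w}f)²)`), **`weighted_pointwise_le`**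
  (`e^{w x}|u x| ≤ m_w⁻¹√(Σ(e^{w}f)²)`), **`pointSource_le`** (`f` supported at `z` ⟹ `|u x| ≤ (|f z|∕m_w)·e^{−(w x − w z)}`).
* §2 `abs_sub_le_of_nsmul`, `abs_sub_le_of_sum_nsmul` (a bond-Lipschitz `ρ` is `Σ_μ k_μ`-Lipschitz along `Σ_μ k_μ•ê_μ`),
  `chart_eq_corner_add` ∕ `siteOf_chart_eq_corner_add` (`σ(chart n y z) = σ(chart n y 0) + Σ_μ z_μ•ê_μ`), **`block_oscillation_le`**
  (`|ρ(σ(chart n y z)) − ρ(σ(chart n y z′))| ≤ 2dn`).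
* §3 `weight_bond_letter` ∕ `weight_block_letter` (for `w = (κ∕(n+1))ρ`: `τ = κ∕(n+1)`, `β = 2dκ`), **`inverseHessian_pointSource_decay`**
  (`0 ≤ κ ≤ 1`, `m_κ := min(2,a) − λ − 2dκ² − a(e^{2dκ} − 1) > 0`, `Hu = f` supported at `z` ⟹
  `|u x| ≤ (|f z|∕m_κ)·exp(−κ(ρ x − ρ z)∕(n+1))`), **`inverseHessian_weighted_resolvent`** (any `f`:
  `√(Σ(e^{κρ∕(n+1)}u)²) ≤ m_κ⁻¹√(Σ(e^{κρ∕(n+1)}f)²)`), **`exists_rate`** (`κ = min(1∕(2d+2), (min(2,a)−λ)∕(4d(1+2a)+4))` keeps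
  `m_κ ≥ (min(2,a)−λ)∕2`), and THE HEADLINE **`inverseHessian_local`**: `∃ κ > 0` depending on `(d, a, λ)` ONLY such that for ALL
  `n, s, V ≥ −λ, ρ, u, f, z, x` as above `|u x| ≤ (2|f z|∕(min(2,a) − λ))·exp(−κ(ρ x − ρ z)∕(n+1))`.
* §4 toy.

HONEST (what this is NOT).  Finite sums; the ENTRY bound is the `ℓ²` one (`|H⁻¹(x,z)| ≤ 2∕m` on the diagonal scale — the true
near-diagonal size `≍ (n+1)^{−2}|x−z|^{2−d}` of a second-order inverse is NOT claimed; row sums of `|H⁻¹|` are therefore NOT shown `O(1)`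
here — the β-team's point-column files do that for the FREE operator on `ℤ^d`); rate and constants explicit, far from sharp; no coarse
Schur complement ∕ response ∕ covariance yet (sequel); cubic periods; scalar skeleton ((A3), NC-NE7b-α UNRULED); [B4] Theorem p. 573
(1.10) is the printed MODEL (covariant, η-lattice, regions) — locator only, nothing of it asserted or discharged; nothing of Bałaban's.
BY-NAME EFFECT ON THE WALL: NONE.  NE7b NOT PRINTED ∕ NOT PROVED; spine PROVED 0∕9; rung (B)+1 on a FINITE torus — NOT infinite volume,
NOT the mass gap, NOT Clay.  HONEST DEPENDENCY: continuum YM on T⁴ ⇐ BetaPertH ∧ nine spine estimates (0∕9 proved); BetaPertH ⇐ (D1) ∧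
(D4) ∧ CAP+tail; G-an2-4 gates asym, D1 and NE2∕3∕4.
-/

set_option autoImplicit false

noncomputable section

namespace Summit.QuantumFields.BalabanUV.T4Continuum.NE7b.SupTorusHessianCombesThomas

open Real
open Literature.MathematicalPhysics.QuantumFieldTheory.Balaban1983to89
open B6QGQLower276 (X e blk B side chart mem_B sum_B sum_B_const card_cube)
open Beta (Site siteOf windowMap siteOf_windowMap siteOf_add)
open SupTorusConjugatedForm (weighted_form_lower)

variable {d : ℕ}

/-! ## §1. The weighted resolvent letter, the pointwise letter, point sources -/

section Resolvent

variable (n : ℕ) (a : ℝ) (s : ℕ) [NeZero s] (ha : 0 ≤ a) (u w V f : Site d ((n + 1) * s) → ℝ) {τ β lam : ℝ} (hτ : τ ≤ 1)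
  (hwb : ∀ x μ, |w (x + siteOf d ((n + 1) * s) (e μ)) - w x| ≤ τ)
  (hwB : ∀ (y : Site d s) (z z' : Fin d → Fin (n + 1)),
    |w (siteOf d ((n + 1) * s) (chart n (windowMap d s y) z)) - w (siteOf d ((n + 1) * s) (chart n (windowMap d s y) z'))| ≤ β)
  (hV : ∀ x, -lam ≤ V x)
  (hm : 0 < min 2 a - lam - 2 * d * (((n : ℝ) + 1) * τ) ^ 2 - a * (exp β - 1))
  (hu : ∀ x, ((n : ℝ) + 1) ^ 2 * ∑ μ, (2 * u x - u (x + siteOf d ((n + 1) * s) (e μ)) - u (x - siteOf d ((n + 1) * s) (e μ)))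
      + a / ((n : ℝ) + 1) ^ d * ∑ q ∈ B n (blk n (windowMap d ((n + 1) * s) x)), u (siteOf d ((n + 1) * s) q)
      + V x * u x = f x)

include ha hτ hwb hwB hV hm hu in
/-- **THE WEIGHTED RESOLVENT LETTER**: if `Hu = f` (displayed action, ANY diagonal `V ≥ −λ`) and the weight `w` obeys the bond and block
letters with `m_w := min(2,a) − λ − 2d((n+1)τ)² − a(e^β − 1) > 0`, then `‖e^{w}u‖₂ ≤ m_w⁻¹·‖e^{w}f‖₂`:
`√(Σ_x (e^{w x}u x)²) ≤ m_w⁻¹·√(Σ_x (e^{w x}f x)²)` — every field, every mesh `n`, every period `s`. [folklore] -/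
theorem weighted_resolvent_le :
    √(∑ x, (exp (w x) * u x) ^ 2)
      ≤ (min 2 a - lam - 2 * d * (((n : ℝ) + 1) * τ) ^ 2 - a * (exp β - 1))⁻¹ * √(∑ x, (exp (w x) * f x) ^ 2) := by
  set m := min 2 a - lam - 2 * d * (((n : ℝ) + 1) * τ) ^ 2 - a * (exp β - 1) with hm_def
  have h1 := weighted_form_lower n a s ha u w V hτ hwb hwB hV
  simp only [hu] at h1
  have h2 : ∑ x, exp (w x) ^ 2 * (u x * f x) = ∑ x, (exp (w x) * u x) * (exp (w x) * f x) :=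
    Finset.sum_congr rfl fun x _ => by ring
  rw [h2] at h1
  have hCS := Real.sum_mul_le_sqrt_mul_sqrt Finset.univ (fun x => exp (w x) * u x) (fun x => exp (w x) * f x)
  have hSu : 0 ≤ ∑ x, (exp (w x) * u x) ^ 2 := Finset.sum_nonneg fun x _ => sq_nonneg _
  -- `m·S_u ≤ √S_u·√S_f` with `S_u = (√S_u)²`
  have h3 : m * (√(∑ x, (exp (w x) * u x) ^ 2) * √(∑ x, (exp (w x) * u x) ^ 2))
      ≤ √(∑ x, (exp (w x) * u x) ^ 2) * √(∑ x, (exp (w x) * f x) ^ 2) := by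
    rw [Real.mul_self_sqrt hSu]; exact h1.trans hCS
  by_cases h0 : √(∑ x, (exp (w x) * u x) ^ 2) = 0
  · rw [h0]; positivity
  · have hpos : 0 < √(∑ x, (exp (w x) * u x) ^ 2) := lt_of_le_of_ne (Real.sqrt_nonneg _) (Ne.symm h0)
    have h4 : m * √(∑ x, (exp (w x) * u x) ^ 2) ≤ √(∑ x, (exp (w x) * f x) ^ 2) := by
      refine le_of_mul_le_mul_right ?_ hpos
      calc m * √(∑ x, (exp (w x) * u x) ^ 2) * √(∑ x, (exp (w x) * u x) ^ 2)
          = m * (√(∑ x, (exp (w x) * u x) ^ 2) * √(∑ x, (exp (w x) * u x) ^ 2)) := by ring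
        _ ≤ √(∑ x, (exp (w x) * u x) ^ 2) * √(∑ x, (exp (w x) * f x) ^ 2) := h3
        _ = √(∑ x, (exp (w x) * f x) ^ 2) * √(∑ x, (exp (w x) * u x) ^ 2) := mul_comm _ _
    calc √(∑ x, (exp (w x) * u x) ^ 2) = m⁻¹ * (m * √(∑ x, (exp (w x) * u x) ^ 2)) := by
          rw [← mul_assoc, inv_mul_cancel₀ hm.ne', one_mul]
      _ ≤ m⁻¹ * √(∑ x, (exp (w x) * f x) ^ 2) := mul_le_mul_of_nonneg_left h4 (inv_nonneg.2 hm.le)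

include ha hτ hwb hwB hV hm hu in
/-- **THE WEIGHTED POINTWISE LETTER**: `e^{w x}·|u x| ≤ m_w⁻¹·√(Σ_{x′} (e^{w x′}f x′)²)` at every site. [folklore] -/
theorem weighted_pointwise_le (x : Site d ((n + 1) * s)) :
    exp (w x) * |u x|
      ≤ (min 2 a - lam - 2 * d * (((n : ℝ) + 1) * τ) ^ 2 - a * (exp β - 1))⁻¹ * √(∑ x', (exp (w x') * f x') ^ 2) := by
  have h := weighted_resolvent_le n a s ha u w V f hτ hwb hwB hV hm hu
  have hx : exp (w x) * |u x| ≤ √(∑ x', (exp (w x') * u x') ^ 2) := by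
    rw [← abs_of_pos (exp_pos (w x)), ← abs_mul, ← Real.sqrt_sq_eq_abs]
    exact Real.sqrt_le_sqrt (Finset.single_le_sum (f := fun x' => (exp (w x') * u x') ^ 2) (fun _ _ => sq_nonneg _)
      (Finset.mem_univ x))
  exact hx.trans h

include ha hτ hwb hwB hV hm hu in
/-- **POINT SOURCES**: if `f` is supported at the single site `z`, then `|u x| ≤ (|f z|∕m_w)·e^{−(w x − w z)}` at every `x` — the column
`z` of the inverse of `H` decays like `e^{−(w x − w z)}` for EVERY admissible weight. [folklore] -/
theorem pointSource_le {z : Site d ((n + 1) * s)} (hf : ∀ x, x ≠ z → f x = 0) (x : Site d ((n + 1) * s)) :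
    |u x| ≤ |f z| / (min 2 a - lam - 2 * d * (((n : ℝ) + 1) * τ) ^ 2 - a * (exp β - 1)) * exp (-(w x - w z)) := by
  set m := min 2 a - lam - 2 * d * (((n : ℝ) + 1) * τ) ^ 2 - a * (exp β - 1) with hm_def
  have h := weighted_pointwise_le n a s ha u w V f hτ hwb hwB hV hm hu x
  have hS : ∑ x', (exp (w x') * f x') ^ 2 = (exp (w z) * f z) ^ 2 := by
    rw [Finset.sum_eq_single z (fun x' _ hx' => by rw [hf x' hx', mul_zero, zero_pow two_ne_zero])
      (fun hz => (hz (Finset.mem_univ z)).elim)]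
  rw [hS, Real.sqrt_sq_eq_abs, abs_mul, abs_of_pos (exp_pos (w z))] at h
  have hex : 0 < exp (w x) := exp_pos (w x)
  rw [show |f z| / m * exp (-(w x - w z)) = (m⁻¹ * (exp (w z) * |f z|)) / exp (w x) by
    rw [neg_sub, exp_sub]; field_simp]
  rw [le_div_iff₀ hex, mul_comm]
  exact h

end Resolvent

/-! ## §2. Weights from bond-Lipschitz observables and their two letters -/

section Observable

variable {N : ℕ} [NeZero N]

omit [NeZero N] in
/-- A bond-Lipschitz observable is `k`-Lipschitz along `k` steps of one bond. [folklore] -/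
theorem abs_sub_le_of_nsmul (ρ : Site d N → ℝ) (t : Site d N) (hρ : ∀ x, |ρ (x + t) - ρ x| ≤ 1) :
    ∀ (k : ℕ) (x : Site d N), |ρ (x + k • t) - ρ x| ≤ k
  | 0, x => by simp
  | k + 1, x => by
      have ih := abs_sub_le_of_nsmul ρ t hρ k x
      have h1 := hρ (x + k • t)
      rw [succ_nsmul, ← add_assoc, Nat.cast_succ]
      calc |ρ (x + k • t + t) - ρ x| = |(ρ (x + k • t + t) - ρ (x + k • t)) + (ρ (x + k • t) - ρ x)| := by ring_nf
        _ ≤ |ρ (x + k • t + t) - ρ (x + k • t)| + |ρ (x + k • t) - ρ x| := abs_add_le _ _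
        _ ≤ 1 + k := add_le_add h1 ih
        _ = k + 1 := add_comm _ _

omit [NeZero N] in
/-- … and `Σ_{μ∈S} k_μ`-Lipschitz along `k_μ` steps of the bonds `μ ∈ S`. [folklore] -/
theorem abs_sub_le_of_sum_nsmul {ι : Type*} (ρ : Site d N → ℝ) (t : ι → Site d N) (hρ : ∀ x μ, |ρ (x + t μ) - ρ x| ≤ 1)
    (k : ι → ℕ) (S : Finset ι) (x : Site d N) :
    |ρ (x + ∑ μ ∈ S, k μ • t μ) - ρ x| ≤ ∑ μ ∈ S, (k μ : ℝ) := by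
  classical
  induction S using Finset.induction_on generalizing x with
  | empty => simp
  | insert μ S hμ ih =>
      rw [Finset.sum_insert hμ, Finset.sum_insert hμ, add_comm (k μ • t μ), ← add_assoc]
      have h1 := abs_sub_le_of_nsmul ρ (t μ) (fun x => hρ x μ) (k μ) (x + ∑ ν ∈ S, k ν • t ν)
      have h2 := ih x
      calc |ρ (x + ∑ ν ∈ S, k ν • t ν + k μ • t μ) - ρ x|
          = |(ρ (x + ∑ ν ∈ S, k ν • t ν + k μ • t μ) - ρ (x + ∑ ν ∈ S, k ν • t ν)) + (ρ (x + ∑ ν ∈ S, k ν • t ν) - ρ x)| := by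
            ring_nf
        _ ≤ |ρ (x + ∑ ν ∈ S, k ν • t ν + k μ • t μ) - ρ (x + ∑ ν ∈ S, k ν • t ν)| + |ρ (x + ∑ ν ∈ S, k ν • t ν) - ρ x| :=
            abs_add_le _ _
        _ ≤ k μ + ∑ ν ∈ S, (k ν : ℝ) := add_le_add h1 h2

/-- The sites of one lattice block from its corner: `chart n y z = chart n y 0 + Σ_μ z_μ • e_μ`. [folklore] -/
theorem chart_eq_corner_add (n : ℕ) (y : X d) (z : Fin d → Fin (n + 1)) :
    chart n y z = chart n y 0 + ∑ μ, ((z μ : ℕ) : ℕ) • e μ := by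
  funext ν
  rw [Pi.add_apply, Finset.sum_apply]
  have hsm : ∀ μ : Fin d, (((z μ : ℕ) : ℕ) • e μ) ν = ((z μ : ℕ) : ℤ) * e μ ν := fun μ => by
    rw [Pi.smul_apply, nsmul_eq_mul]
  simp only [hsm]
  rw [Finset.sum_eq_single ν (fun μ _ hμ => by rw [B6QGQLower276.e_apply_ne (Ne.symm hμ), mul_zero])
    (fun h => (h (Finset.mem_univ ν)).elim), B6QGQLower276.e_apply_self, mul_one]
  simp [chart]

omit [NeZero N] in
/-- The same on the torus: `σ(chart n y z) = σ(chart n y 0) + Σ_μ z_μ • ê_μ`. [folklore] -/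
theorem siteOf_chart_eq_corner_add (n : ℕ) (y : X d) (z : Fin d → Fin (n + 1)) :
    siteOf d N (chart n y z) = siteOf d N (chart n y 0) + ∑ μ, ((z μ : ℕ) : ℕ) • siteOf d N (e μ) := by
  let σ : (X d) →+ Site d N := AddMonoidHom.mk' (siteOf d N) (siteOf_add N)
  have hσ : ∀ p, siteOf d N p = σ p := fun _ => rfl
  rw [chart_eq_corner_add, hσ, map_add, map_sum]
  simp only [map_nsmul, hσ]

omit [NeZero N] in
/-- **THE BLOCK OSCILLATION OF A BOND-LIPSCHITZ OBSERVABLE IS AT MOST `2dn`**: `|ρ(x + ê_μ) − ρ x| ≤ 1` for all `x, μ` ⟹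
`|ρ(σ(chart n y z)) − ρ(σ(chart n y z′))| ≤ 2dn` for all `z, z′` (both sites are within `Σ_μ z_μ ≤ dn` bond steps of the corner).
[folklore] -/
theorem block_oscillation_le (n : ℕ) (ρ : Site d N → ℝ) (hρ : ∀ x μ, |ρ (x + siteOf d N (e μ)) - ρ x| ≤ 1) (y : X d)
    (z z' : Fin d → Fin (n + 1)) :
    |ρ (siteOf d N (chart n y z)) - ρ (siteOf d N (chart n y z'))| ≤ 2 * d * n := by
  have hcorner : ∀ z'' : Fin d → Fin (n + 1), |ρ (siteOf d N (chart n y z'')) - ρ (siteOf d N (chart n y 0))| ≤ d * n := by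
    intro z''
    rw [siteOf_chart_eq_corner_add n y z'']
    refine (abs_sub_le_of_sum_nsmul ρ (fun μ => siteOf d N (e μ)) hρ (fun μ => (z'' μ : ℕ)) Finset.univ _).trans ?_
    calc ∑ μ, ((z'' μ : ℕ) : ℝ) ≤ ∑ _μ : Fin d, (n : ℝ) := Finset.sum_le_sum fun μ _ => by exact_mod_cast Fin.is_le (z'' μ)
      _ = d * n := by rw [Finset.sum_const, Finset.card_univ, Fintype.card_fin, nsmul_eq_mul]
  have h1 := hcorner z
  have h2 := hcorner z'
  rw [abs_sub_comm] at h2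
  calc |ρ (siteOf d N (chart n y z)) - ρ (siteOf d N (chart n y z'))|
      = |(ρ (siteOf d N (chart n y z)) - ρ (siteOf d N (chart n y 0))) + (ρ (siteOf d N (chart n y 0)) - ρ (siteOf d N (chart n y z')))| := by
        ring_nf
    _ ≤ d * n + d * n := (abs_add_le _ _).trans (add_le_add h1 h2)
    _ = 2 * d * n := by ring

end Observable

/-! ## §3. THE END: the inverse Hessian of the torus action is local at the block scale -/

section End

variable (n : ℕ) (a : ℝ) (s : ℕ) [NeZero s]

omit [NeZero s] in
/-- The bond letter of the weight `w = (κ∕(n+1))·ρ` for a bond-Lipschitz `ρ`: `τ = κ∕(n+1)`. [folklore] -/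
theorem weight_bond_letter (ρ : Site d ((n + 1) * s) → ℝ) (hρ : ∀ x μ, |ρ (x + siteOf d ((n + 1) * s) (e μ)) - ρ x| ≤ 1)
    {κ : ℝ} (hκ : 0 ≤ κ) (x : Site d ((n + 1) * s)) (μ : Fin d) :
    |κ / ((n : ℝ) + 1) * ρ (x + siteOf d ((n + 1) * s) (e μ)) - κ / ((n : ℝ) + 1) * ρ x| ≤ κ / ((n : ℝ) + 1) := by
  rw [← mul_sub, abs_mul, abs_of_nonneg (by positivity : 0 ≤ κ / ((n : ℝ) + 1))]
  exact mul_le_of_le_one_right (by positivity) (hρ x μ)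

/-- The block letter of the weight `w = (κ∕(n+1))·ρ` for a bond-Lipschitz `ρ`: `β = 2dκ` (block oscillation `2dn ≤ 2d(n+1)`). [folklore] -/
theorem weight_block_letter (ρ : Site d ((n + 1) * s) → ℝ) (hρ : ∀ x μ, |ρ (x + siteOf d ((n + 1) * s) (e μ)) - ρ x| ≤ 1)
    {κ : ℝ} (hκ : 0 ≤ κ) (y : Site d s) (z z' : Fin d → Fin (n + 1)) :
    |κ / ((n : ℝ) + 1) * ρ (siteOf d ((n + 1) * s) (chart n (windowMap d s y) z))
        - κ / ((n : ℝ) + 1) * ρ (siteOf d ((n + 1) * s) (chart n (windowMap d s y) z'))| ≤ 2 * d * κ := by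
  rw [← mul_sub, abs_mul, abs_of_nonneg (by positivity : 0 ≤ κ / ((n : ℝ) + 1))]
  have h := block_oscillation_le n ρ hρ (windowMap d s y) z z'
  have hn : (0 : ℝ) < (n : ℝ) + 1 := by positivity
  calc κ / ((n : ℝ) + 1) * |ρ (siteOf d ((n + 1) * s) (chart n (windowMap d s y) z))
          - ρ (siteOf d ((n + 1) * s) (chart n (windowMap d s y) z'))|
      ≤ κ / ((n : ℝ) + 1) * (2 * d * n) := mul_le_mul_of_nonneg_left h (by positivity)
    _ = 2 * d * κ * (n / ((n : ℝ) + 1)) := by ring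
    _ ≤ 2 * d * κ * 1 := by
        refine mul_le_mul_of_nonneg_left ((div_le_one hn).2 (by linarith)) (by positivity)
    _ = 2 * d * κ := mul_one _

/-- **THE INVERSE HESSIAN OF THE TORUS ACTION IS LOCAL AT THE BLOCK SCALE — every field, every mesh, every volume, every rate `κ` in
the window.**  On the fine torus `(ℤ∕(n+1)s)^d` let `H = (n+1)²(−Δ) + a(n+1)^{−d}·(block sums) + V` with ANY diagonal `V ≥ −λ` (for
the torus action `S φ = ½⟨φ, At φ⟩ + Σ v(φ)` of the road this is the Hessian `S″(φ) = At + diag(u′∘φ)` at ANY field `φ`, `u′ ≥ −λ`),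
let `ρ` be ANY bond-Lipschitz observable (`|ρ(x + ê_μ) − ρ x| ≤ 1`), `0 ≤ κ ≤ 1` with
`m_κ := min(2,a) − λ − 2dκ² − a(e^{2dκ} − 1) > 0`.  If `Hu = f` with `f` supported at one site `z`, then at every site `x`
`|u x| ≤ (|f z|∕m_κ)·exp(−κ·(ρ x − ρ z)∕(n+1))`: the column `z` of `H⁻¹` decays exponentially in `ρ∕(n+1)` — the BLOCK scale — with
constants depending on `(d, a, λ, κ)` only.  Combes–Thomas on the coercive torus form (§4) with the weight `(κ∕(n+1))·ρ`. [folklore] -/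
theorem inverseHessian_pointSource_decay (ha : 0 ≤ a) {lam κ : ℝ} (hκ0 : 0 ≤ κ) (hκ1 : κ ≤ 1)
    (hm : 0 < min 2 a - lam - 2 * d * κ ^ 2 - a * (exp (2 * d * κ) - 1))
    (V : Site d ((n + 1) * s) → ℝ) (hV : ∀ x, -lam ≤ V x)
    (ρ : Site d ((n + 1) * s) → ℝ) (hρ : ∀ x μ, |ρ (x + siteOf d ((n + 1) * s) (e μ)) - ρ x| ≤ 1)
    (u f : Site d ((n + 1) * s) → ℝ)
    (hu : ∀ x, ((n : ℝ) + 1) ^ 2 * ∑ μ, (2 * u x - u (x + siteOf d ((n + 1) * s) (e μ)) - u (x - siteOf d ((n + 1) * s) (e μ)))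
      + a / ((n : ℝ) + 1) ^ d * ∑ q ∈ B n (blk n (windowMap d ((n + 1) * s) x)), u (siteOf d ((n + 1) * s) q)
      + V x * u x = f x)
    {z : Site d ((n + 1) * s)} (hf : ∀ x, x ≠ z → f x = 0) (x : Site d ((n + 1) * s)) :
    |u x| ≤ |f z| / (min 2 a - lam - 2 * d * κ ^ 2 - a * (exp (2 * d * κ) - 1))
      * exp (-(κ / ((n : ℝ) + 1) * (ρ x - ρ z))) := by
  have hn : (0 : ℝ) < (n : ℝ) + 1 := by positivity
  have hτ : κ / ((n : ℝ) + 1) ≤ 1 := ((div_le_one hn).2 (hκ1.trans (by linarith))).trans le_rfl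
  have hτ' : ((n : ℝ) + 1) * (κ / ((n : ℝ) + 1)) = κ := by field_simp
  have hm' : 0 < min 2 a - lam - 2 * d * (((n : ℝ) + 1) * (κ / ((n : ℝ) + 1))) ^ 2 - a * (exp (2 * d * κ) - 1) := by
    rwa [hτ']
  have h := pointSource_le n a s ha u (fun x => κ / ((n : ℝ) + 1) * ρ x) V f hτ (weight_bond_letter n s ρ hρ hκ0)
    (weight_block_letter n s ρ hρ hκ0) hV hm' hu hf x
  rw [hτ'] at h
  convert h using 2
  ring

/-- **THE WEIGHTED RESOLVENT FORM OF THE SAME** (any source `f`): `‖e^{κρ∕(n+1)}u‖₂ ≤ m_κ⁻¹·‖e^{κρ∕(n+1)}f‖₂`. [folklore] -/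
theorem inverseHessian_weighted_resolvent (ha : 0 ≤ a) {lam κ : ℝ} (hκ0 : 0 ≤ κ) (hκ1 : κ ≤ 1)
    (hm : 0 < min 2 a - lam - 2 * d * κ ^ 2 - a * (exp (2 * d * κ) - 1))
    (V : Site d ((n + 1) * s) → ℝ) (hV : ∀ x, -lam ≤ V x)
    (ρ : Site d ((n + 1) * s) → ℝ) (hρ : ∀ x μ, |ρ (x + siteOf d ((n + 1) * s) (e μ)) - ρ x| ≤ 1)
    (u f : Site d ((n + 1) * s) → ℝ)
    (hu : ∀ x, ((n : ℝ) + 1) ^ 2 * ∑ μ, (2 * u x - u (x + siteOf d ((n + 1) * s) (e μ)) - u (x - siteOf d ((n + 1) * s) (e μ)))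
      + a / ((n : ℝ) + 1) ^ d * ∑ q ∈ B n (blk n (windowMap d ((n + 1) * s) x)), u (siteOf d ((n + 1) * s) q)
      + V x * u x = f x) :
    √(∑ x, (exp (κ / ((n : ℝ) + 1) * ρ x) * u x) ^ 2)
      ≤ (min 2 a - lam - 2 * d * κ ^ 2 - a * (exp (2 * d * κ) - 1))⁻¹ * √(∑ x, (exp (κ / ((n : ℝ) + 1) * ρ x) * f x) ^ 2) := by
  have hn : (0 : ℝ) < (n : ℝ) + 1 := by positivity
  have hτ : κ / ((n : ℝ) + 1) ≤ 1 := (div_le_one hn).2 (hκ1.trans (by linarith))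
  have hτ' : ((n : ℝ) + 1) * (κ / ((n : ℝ) + 1)) = κ := by field_simp
  have hm' : 0 < min 2 a - lam - 2 * d * (((n : ℝ) + 1) * (κ / ((n : ℝ) + 1))) ^ 2 - a * (exp (2 * d * κ) - 1) := by
    rwa [hτ']
  have h := weighted_resolvent_le n a s ha u (fun x => κ / ((n : ℝ) + 1) * ρ x) V f hτ (weight_bond_letter n s ρ hρ hκ0)
    (weight_block_letter n s ρ hρ hκ0) hV hm' hu
  rwa [hτ'] at h

/-- **A RATE ALWAYS EXISTS**: for `a ≥ 0` and `λ < min(2,a)` the explicit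
`κ = min(1∕(2d+2), (min(2,a) − λ)∕(4d(1+2a) + 4)) ∈ (0, 1]` keeps half the floor: `(min(2,a) − λ)∕2 ≤ m_κ`. [folklore] -/
theorem exists_rate (ha : 0 ≤ a) {lam : ℝ} (hm0 : 0 < min 2 a - lam) :
    ∃ κ : ℝ, 0 < κ ∧ κ ≤ 1 ∧ (min 2 a - lam) / 2 ≤ min 2 a - lam - 2 * d * κ ^ 2 - a * (exp (2 * d * κ) - 1) := by
  set m0 := min 2 a - lam with hm0_def
  have hd : (0 : ℝ) ≤ d := Nat.cast_nonneg d
  refine ⟨min (1 / (2 * (d : ℝ) + 2)) (m0 / (4 * d * (1 + 2 * a) + 4)), lt_min (by positivity) (by positivity), ?_, ?_⟩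
  · exact (min_le_left _ _).trans (by rw [div_le_one (by positivity)]; linarith)
  · set κ := min (1 / (2 * (d : ℝ) + 2)) (m0 / (4 * d * (1 + 2 * a) + 4)) with hκ_def
    have hκ0 : 0 ≤ κ := le_min (by positivity) (by positivity)
    have hκ1 : κ ≤ 1 / (2 * (d : ℝ) + 2) := min_le_left _ _
    have hκ2 : κ ≤ m0 / (4 * d * (1 + 2 * a) + 4) := min_le_right _ _
    have hdk : 2 * d * κ ≤ 1 := by
      have h1 := mul_le_mul_of_nonneg_left hκ1 (by positivity : (0 : ℝ) ≤ 2 * d)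
      have h2 : 2 * (d : ℝ) * (1 / (2 * (d : ℝ) + 2)) ≤ 1 := by
        rw [mul_one_div, div_le_one (by positivity)]; linarith
      exact h1.trans h2
    have hκle1 : κ ≤ 1 := hκ1.trans (by rw [div_le_one (by positivity)]; linarith)
    -- `e^{2dκ} − 1 ≤ 4dκ` and `2dκ² ≤ 2dκ`
    have hexp : exp (2 * d * κ) - 1 ≤ 2 * (2 * d * κ) := by
      have h := abs_exp_sub_one_le (x := 2 * d * κ) (by rw [abs_of_nonneg (by positivity)]; exact hdk)
      rw [abs_of_nonneg (by positivity : (0 : ℝ) ≤ 2 * d * κ)] at h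
      exact (le_abs_self _).trans h
    have hsq : 2 * d * κ ^ 2 ≤ 2 * d * κ := by
      rw [sq]; exact mul_le_mul_of_nonneg_left (mul_le_of_le_one_right hκ0 hκle1) (by positivity)
    have hlin : (2 * d + 4 * d * a) * κ ≤ m0 / 2 := by
      have h := mul_le_mul_of_nonneg_left hκ2 (by positivity : (0 : ℝ) ≤ 2 * d + 4 * d * a)
      refine h.trans ?_
      rw [mul_div_assoc', div_le_div_iff₀ (by positivity) (by positivity)]
      nlinarith
    nlinarith [mul_le_mul_of_nonneg_left hexp ha]

/-- **HEADLINE.**  For every dimension `d`, block coupling `a ≥ 0` and potential floor `λ < min(2,a)` there is a rate `κ > 0` — depending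
on NOTHING ELSE — such that on EVERY fine torus `(ℤ∕(n+1)s)^d` (every mesh `n`, every period `s`), for EVERY diagonal `V ≥ −λ`, EVERY
bond-Lipschitz observable `ρ` and every solution of `Hu = f` with `f` supported at one site `z`:
`|u x| ≤ (2|f z|∕(min(2,a) − λ))·exp(−κ(ρ x − ρ z)∕(n+1))`.  The located «mesh-UNIFORM locality» of the torus road's Hessian inverse,
by Combes–Thomas on the FORM (no block-constant weights, no multiplier). [folklore] -/
theorem inverseHessian_local (ha : 0 ≤ a) {lam : ℝ} (hm0 : 0 < min 2 a - lam) :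
    ∃ κ : ℝ, 0 < κ ∧ ∀ (n s : ℕ) [NeZero s] (V : Site d ((n + 1) * s) → ℝ), (∀ x, -lam ≤ V x) →
      ∀ ρ : Site d ((n + 1) * s) → ℝ, (∀ x μ, |ρ (x + siteOf d ((n + 1) * s) (e μ)) - ρ x| ≤ 1) →
      ∀ u f : Site d ((n + 1) * s) → ℝ,
        (∀ x, ((n : ℝ) + 1) ^ 2 * ∑ μ, (2 * u x - u (x + siteOf d ((n + 1) * s) (e μ)) - u (x - siteOf d ((n + 1) * s) (e μ)))
          + a / ((n : ℝ) + 1) ^ d * ∑ q ∈ B n (blk n (windowMap d ((n + 1) * s) x)), u (siteOf d ((n + 1) * s) q)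
          + V x * u x = f x) →
      ∀ z : Site d ((n + 1) * s), (∀ x, x ≠ z → f x = 0) →
      ∀ x, |u x| ≤ 2 * |f z| / (min 2 a - lam) * exp (-(κ / ((n : ℝ) + 1) * (ρ x - ρ z))) := by
  obtain ⟨κ, hκ0, hκ1, hκm⟩ := exists_rate (d := d) a ha hm0
  refine ⟨κ, hκ0, fun n s _ V hV ρ hρ u f hu z hf x => ?_⟩
  have hm : 0 < min 2 a - lam - 2 * d * κ ^ 2 - a * (exp (2 * d * κ) - 1) := lt_of_lt_of_le (by linarith) hκm
  have h := inverseHessian_pointSource_decay n a s ha hκ0.le hκ1 hm V hV ρ hρ u f hu hf x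
  refine h.trans (mul_le_mul_of_nonneg_right ?_ (exp_pos _).le)
  rw [div_le_div_iff₀ hm (by linarith)]
  nlinarith [abs_nonneg (f z)]

end End


/-! ## §4. Toy -/

/-- Toy (`a = 1`, `λ = 0`, any `d`): the headline's hypotheses `0 ≤ a`, `0 < min(2,a) − λ` are inhabited, so a rate exists. -/
example : ∃ κ : ℝ, 0 < κ ∧ κ ≤ 1 ∧ (min 2 (1 : ℝ) - 0) / 2 ≤ min 2 (1 : ℝ) - 0 - 2 * d * κ ^ 2 - 1 * (exp (2 * d * κ) - 1) :=
  exists_rate (d := d) 1 zero_le_one (by norm_num)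

/-- Toy (`d = 1`, `n = 0`, `s = 1`): the constant observable `ρ = 0` is bond-Lipschitz, so `inverseHessian_local`'s observable slot is
inhabited on every torus (giving the plain `ℓ² → ℓ^∞` bound `|u x| ≤ 2|f z|∕(min(2,a) − λ)`). -/
example : ∀ (x : Site 1 ((0 + 1) * 1)) (μ : Fin 1),
    |(fun _ => (0 : ℝ)) (x + siteOf 1 ((0 + 1) * 1) (e μ)) - (fun _ => (0 : ℝ)) x| ≤ 1 := fun _ _ => by simp

end Summit.QuantumFields.BalabanUV.T4Continuum.NE7b.SupTorusHessianCombesThomas
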